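import Mathlib
import HarnessLib
import Summits.MatrixMultiplication.MatrixMultiplication.Theses.BrentRefutationDepth
import Literature.Computability.AlgebraicComplexity.SmallFormatRankProofs
import Literature.Computability.AlgebraicComplexity.SmallFormatRankLaderman
import Literature.Computability.AlgebraicComplexity.MatMulRankLowerBoundsBlaserProofs
import Literature.Computability.AlgebraicComplexity.HasNSRefutation
import Literature.Computability.Complexity.SumOfSquaresRefutation

/-!
# MatrixMultiplication / BrentRefutationDepth — support item `RealThreeByThreeTwenty`
(stmt-MatrixMultiplication-5588): what is provable now

The item is `20 ≤ R_ℝ(⟨3,3,3⟩)` (`tensorRank (matMulTensor ℝ 3 3 3)`), the REAL rank of the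
`3 × 3` matrix multiplication tensor.  It lies one unit beyond the published (and in-tree, fully
proved) frontier `19 ≤ R_K(⟨3,3,3⟩) ≤ 23` for every field `K` (Bläser 2003, Cor. 9 —
`blaser2003_cor9_holds`; Laderman 1976 — `tensorRank_matMulTensor_three_le_twentyThree`), and the
route itself files it as an open problem ("FIRST SOS TARGET (open)").  This helper file records,
sorry-free, everything about the item that the tree can presently certify:

* `tensorRank_matMulTensor_complex_le_real` — base change `ℝ → ℂ`: `R_ℂ(⟨k,m,n⟩) ≤ R_ℝ(⟨k,m,n⟩)`;
  hence **the complex crux implies the real item**,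
  `realThreeByThreeTwenty_of_threeByThreeTwenty : ThreeByThreeTwenty → RealThreeByThreeTwenty`
  (the route's remark "weaker than ThreeByThreeTwenty (R_ℝ ≥ R_ℂ)", made formal).
* `nineteen_le_tensorRank_matMulTensor_real_three`, `tensorRank_matMulTensor_real_three_le` —
  the real window `19 ≤ R_ℝ(⟨3,3,3⟩) ≤ 23`; so the item is exactly `R_ℝ(⟨3,3,3⟩) ≠ 19`
  (`realThreeByThreeTwenty_iff_ne_nineteen`).
* `realThreeByThreeTwenty_iff_forall_ne_sum_triad` — the item says precisely that `⟨3,3,3⟩` is not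
  a sum of `19` real triads, i.e. (`realThreeByThreeTwenty_iff_brentSystem_no_real_zero`) that the
  real Brent system `B_ℝ(3,19)` (`brentSystem ℝ 3 19`: `729` cubics in `513` unknowns) has no real
  zero — the statement a Positivstellensatz certificate would establish.
* `lt_tensorRank_of_hasSOSRefutation_brentSystem` — **soundness of the SOS engine** over any
  linearly ordered field: a static Positivstellensatz refutation (`HasSOSRefutation`, Grigoriev 2001
  Def. 0.5) of `B_K(n,r)` in any degree certifies `r < R_K(⟨n,n,n⟩)`; in particular
  `realThreeByThreeTwenty_of_hasSOSRefutation : HasSOSRefutation B_ℝ(3,19) d → RealThreeByThreeTwenty`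
  and the NS version `realThreeByThreeTwenty_of_hasBrentRefutation`.

What is NOT here: a proof of the item (open: no technique in print separates `19` from `20`, over
`ℝ` or `ℂ`), nor a refutation (it would be a `19`-multiplication real algorithm for `3 × 3`
matrices; none is known, the best is Laderman's `23`).

References: M. Bläser, *On the complexity of the multiplication of matrices of small formats*,
J. Complexity 19 (2003), Cor. 9; J. Laderman, Bull. AMS 82 (1976); M. Bläser, *Fast Matrix
Multiplication*, ToC Graduate Surveys 5 (2013), §4–5; D. Grigoriev, *Complexity of
Positivstellensatz proofs for the knapsack*, Comput. Complexity 10 (2001), Def. 0.5;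
M. Heule, M. Kauers, M. Seidl, *New ways to multiply 3 × 3-matrices*, JSC 104 (2021), §2.
-/

set_option linter.dupNamespace false

noncomputable section

namespace Summit.MatrixMultiplication.MatrixMultiplication.Theorems

open scoped BigOperators
open Literature.Computability.AlgebraicComplexity Literature.Computability.Complexity
open Summit.MatrixMultiplication.MatrixMultiplication.Theses.BrentRefutationDepth

/-! ## Base change `ℝ → ℂ`: the complex crux implies the real item -/

/-- Base change along `ℝ → ℂ` does not increase rank: `R_ℂ(⟨k,m,n⟩) ≤ R_ℝ(⟨k,m,n⟩)` (a real
decomposition is a complex one; Bläser 1999, §5 (10), `tensorRank_matMulTensor_map_le`).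
[cite: Blaser1999, §5 eq. (10)] -/
theorem tensorRank_matMulTensor_complex_le_real (k m n : ℕ) :
    tensorRank (matMulTensor ℂ k m n) ≤ tensorRank (matMulTensor ℝ k m n) :=
  tensorRank_matMulTensor_map_le (algebraMap ℝ ℂ) k m n

/-- **The complex `3 × 3` window crux implies the real item**:
`ThreeByThreeTwenty → RealThreeByThreeTwenty`, i.e. `20 ≤ R_ℂ(⟨3,3,3⟩) → 20 ≤ R_ℝ(⟨3,3,3⟩)`
(the route's "weaker than ThreeByThreeTwenty (R_ℝ ≥ R_ℂ)"). [cite: Blaser1999, §5 eq. (10)] -/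
theorem realThreeByThreeTwenty_of_threeByThreeTwenty (h : ThreeByThreeTwenty) :
    RealThreeByThreeTwenty := by
  unfold RealThreeByThreeTwenty
  unfold ThreeByThreeTwenty at h
  exact h.trans (tensorRank_matMulTensor_complex_le_real 3 3 3)

/-! ## The real window `19 ≤ R_ℝ(⟨3,3,3⟩) ≤ 23` -/

/-- **Frontier**: `19 ≤ R_ℝ(⟨3,3,3⟩)` — Bläser 2003, Corollary 9, over every field, fully proved
in the tree (`blaser2003_cor9_holds`), specialised to `ℝ`. [cite: Blaser2003, Corollary 9] -/
theorem nineteen_le_tensorRank_matMulTensor_real_three :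
    19 ≤ tensorRank (matMulTensor ℝ 3 3 3) :=
  blaser2003_cor9_holds ℝ

/-- Laderman's bound over `ℝ`: `R_ℝ(⟨3,3,3⟩) ≤ 23`. [cite: Laderman1976, p. 126] -/
theorem tensorRank_matMulTensor_real_three_le :
    tensorRank (matMulTensor ℝ 3 3 3) ≤ 23 :=
  tensorRank_matMulTensor_three_le_twentyThree ℝ

/-- Given the window `[19, 23]`, the item `RealThreeByThreeTwenty` is exactly the statement
`R_ℝ(⟨3,3,3⟩) ≠ 19`. [cite: Blaser2003, Corollary 9] -/
theorem realThreeByThreeTwenty_iff_ne_nineteen :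
    RealThreeByThreeTwenty ↔ tensorRank (matMulTensor ℝ 3 3 3) ≠ 19 := by
  unfold RealThreeByThreeTwenty
  have h19 := nineteen_le_tensorRank_matMulTensor_real_three
  omega

/-! ## The item as infeasibility of the real Brent system `B_ℝ(3,19)` -/

/-- `RealThreeByThreeTwenty` says precisely that `⟨3,3,3⟩` is **not** a sum of `19` real triads
(`tensorRank_le_iff`: the infimum defining the rank is attained and decompositions pad).
[cite: Blaser2013, §4] -/
theorem realThreeByThreeTwenty_iff_forall_ne_sum_triad :
    RealThreeByThreeTwenty ↔
      ∀ (w : Fin 19 → Fin 3 × Fin 3 → ℝ) (u : Fin 19 → Fin 3 × Fin 3 → ℝ)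
        (v : Fin 19 → Fin 3 × Fin 3 → ℝ), matMulTensor ℝ 3 3 3 ≠ ∑ s, triad (w s) (u s) (v s) := by
  unfold RealThreeByThreeTwenty
  rw [show (20 ≤ tensorRank (matMulTensor ℝ 3 3 3)) ↔ ¬ tensorRank (matMulTensor ℝ 3 3 3) ≤ 19 by
    omega, tensorRank_le_iff]
  simp only [not_exists]

/-- `RealThreeByThreeTwenty` says precisely that the real Brent system `B_ℝ(3,19)` — `729` cubic
equations in `513` unknowns — has **no real common zero** (`tensorRank_le_iff_exists_brent_zero`).
This is the statement a Positivstellensatz certificate for `B_ℝ(3,19)` would establish.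
[cite: HeuleKauersSeidl2021, §2 (the Brent equations)] -/
theorem realThreeByThreeTwenty_iff_brentSystem_no_real_zero :
    RealThreeByThreeTwenty ↔
      ∀ x : Fin 3 × Fin 19 × (Fin 3 × Fin 3) → ℝ,
        ∃ i j k, MvPolynomial.eval x (brentSystem ℝ 3 19 i j k) ≠ 0 := by
  unfold RealThreeByThreeTwenty
  rw [show (20 ≤ tensorRank (matMulTensor ℝ 3 3 3)) ↔ ¬ tensorRank (matMulTensor ℝ 3 3 3) ≤ 19 by
    omega, tensorRank_le_iff_exists_brent_zero]
  push Not
  rfl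

/-! ## Soundness of the SOS engine for Brent systems -/

/-- **SOS refutations of Brent systems certify rank lower bounds.** Over a linearly ordered field
`K`, a static Positivstellensatz refutation `Σ q_l² + Σ g_{ijk} B_{ijk} = -1` (Grigoriev 2001,
Def. 0.5; any degree `d`) of the Brent system `B_K(n, r)` shows `r < R_K(⟨n,n,n⟩)`: if `R ≤ r`, an
`r`-term decomposition is a common zero of `B_K(n,r)` (`tensorRank_le_iff_exists_brent_zero`), where
the identity evaluates to `Σ (q_l x)² = -1 < 0`. The real-field analogue of the route's
`RefutationSound`. [cite: Grigoriev2001, Def. 0.5] -/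
theorem lt_tensorRank_of_hasSOSRefutation_brentSystem {K : Type*} [Field K] [LinearOrder K]
    [IsStrictOrderedRing K] {n r d : ℕ}
    (h : HasSOSRefutation
      (fun e : (Fin n × Fin n) × (Fin n × Fin n) × (Fin n × Fin n) =>
        brentSystem K n r e.1 e.2.1 e.2.2) d) :
    r < tensorRank (matMulTensor K n n n) := by
  by_contra hle
  rw [not_lt] at hle
  obtain ⟨x, hx⟩ := (tensorRank_le_iff_exists_brent_zero n r).1 hle
  obtain ⟨e, he⟩ := h.no_common_zero x
  exact he (hx e.1 e.2.1 e.2.2)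

/-- **The item from an SOS certificate**: a static Positivstellensatz refutation, of any degree, of
the real Brent system `B_ℝ(3,19)` proves `RealThreeByThreeTwenty` — the route's "exactly what a
Positivstellensatz refutation of the real Brent system B_ℝ(3,19) certifies".
[cite: Grigoriev2001, Def. 0.5] -/
theorem realThreeByThreeTwenty_of_hasSOSRefutation {d : ℕ}
    (h : HasSOSRefutation
      (fun e : (Fin 3 × Fin 3) × (Fin 3 × Fin 3) × (Fin 3 × Fin 3) =>
        brentSystem ℝ 3 19 e.1 e.2.1 e.2.2) d) :
    RealThreeByThreeTwenty := by
  unfold RealThreeByThreeTwenty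
  exact lt_tensorRank_of_hasSOSRefutation_brentSystem h

/-- The item from a Nullstellensatz certificate over `ℝ` (`HasBrentRefutation ℝ 3 19 D`, any
multiplier degree `D`), by `HasBrentRefutation.lt_tensorRank`.
[cite: KrajicekProofComplexity2019, §6.2] -/
theorem realThreeByThreeTwenty_of_hasBrentRefutation {D : ℕ} (h : HasBrentRefutation ℝ 3 19 D) :
    RealThreeByThreeTwenty := by
  unfold RealThreeByThreeTwenty
  exact h.lt_tensorRank

/-- A Nullstellensatz certificate over `ℤ` (or `ℚ`) for `B(3,19)` also proves the real item, by
base change of the certificate (`HasBrentRefutation.map`). [cite: KrajicekProofComplexity2019, §6.2] -/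
theorem realThreeByThreeTwenty_of_hasBrentRefutation_int {D : ℕ} (h : HasBrentRefutation ℤ 3 19 D) :
    RealThreeByThreeTwenty :=
  realThreeByThreeTwenty_of_hasBrentRefutation (h.map (Int.castRingHom ℝ))

/-! ## The complex engine: SOS refutations of the realified complex Brent system

Appended (same item, stmt-MatrixMultiplication-5588): the route's engine for the `3 × 3` window is
a Positivstellensatz refutation of the REALIFICATION of the complex Brent system `B_ℂ(3,19)`
(`realifySystem`: real and imaginary parts of every equation in the `2 · 513 = 1026` real
coordinates). Such a certificate proves the complex crux `ThreeByThreeTwenty`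
(`HasSOSRefutation.no_complex_zero`) and hence, by base change, the real item. -/

/-- **SOS refutations of the realified Brent system certify complex rank lower bounds**: a static
Positivstellensatz refutation (any degree) of `realifySystem B_ℂ(n, r)` shows `r < R_ℂ(⟨n,n,n⟩)` —
an `r`-term complex decomposition would be a complex common zero of `B_ℂ(n,r)`, i.e. a real
common zero of its realification, where the identity evaluates to `Σ (q_l y)² = -1`.
[cite: Grigoriev2001, Def. 0.5] -/
theorem lt_tensorRank_complex_of_hasSOSRefutation_realify {n r d : ℕ}
    (h : HasSOSRefutation (realifySystem
      (fun e : (Fin n × Fin n) × (Fin n × Fin n) × (Fin n × Fin n) =>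
        brentSystem ℂ n r e.1 e.2.1 e.2.2)) d) :
    r < tensorRank (matMulTensor ℂ n n n) := by
  by_contra hle
  rw [not_lt] at hle
  obtain ⟨x, hx⟩ := (tensorRank_le_iff_exists_brent_zero n r).1 hle
  obtain ⟨e, he⟩ := h.no_complex_zero x
  exact he (hx e.1 e.2.1 e.2.2)

/-- **The complex crux from a realified SOS certificate**: a static Positivstellensatz refutation,
of any degree, of the realification of `B_ℂ(3,19)` proves `ThreeByThreeTwenty`
(`20 ≤ R_ℂ(⟨3,3,3⟩)`) — the soundness half of the route's two-layer plan
"SOS certificate for the realification → exact rounding → ThreeByThreeTwenty".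
[cite: Grigoriev2001, Def. 0.5] -/
theorem threeByThreeTwenty_of_hasSOSRefutation_realify {d : ℕ}
    (h : HasSOSRefutation (realifySystem
      (fun e : (Fin 3 × Fin 3) × (Fin 3 × Fin 3) × (Fin 3 × Fin 3) =>
        brentSystem ℂ 3 19 e.1 e.2.1 e.2.2)) d) :
    ThreeByThreeTwenty := by
  unfold ThreeByThreeTwenty
  exact lt_tensorRank_complex_of_hasSOSRefutation_realify h

/-- … and hence the real item `RealThreeByThreeTwenty` (base change,
`realThreeByThreeTwenty_of_threeByThreeTwenty`). [cite: Grigoriev2001, Def. 0.5] -/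
theorem realThreeByThreeTwenty_of_hasSOSRefutation_realify {d : ℕ}
    (h : HasSOSRefutation (realifySystem
      (fun e : (Fin 3 × Fin 3) × (Fin 3 × Fin 3) × (Fin 3 × Fin 3) =>
        brentSystem ℂ 3 19 e.1 e.2.1 e.2.2)) d) :
    RealThreeByThreeTwenty :=
  realThreeByThreeTwenty_of_threeByThreeTwenty (threeByThreeTwenty_of_hasSOSRefutation_realify h)

end Summit.MatrixMultiplication.MatrixMultiplication.Theorems

end
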